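import Summits.ResolutionOfSingularities.ResolutionOfSingularities.Theorems.EquisingularLiftEquisingularLiftNatHypLocPrincipalForm
import Summits.ResolutionOfSingularities.ResolutionOfSingularities.Theorems.EquisingularLiftEquisingularLiftNatLargeCharKInputs
import Literature.AlgebraicGeometry.Resolution.RegularSubschemeLocallyIrreducible
import HarnessLib

/-!
# EL♮ / EL♮(3) / EL — the crux hypothesis, SCHEME-THEORETICALLY: `ker ι = (F)~` and `H ≅ V(F)` over `ℙⁿ_k` for ONE prime form `F`

leafhand-res-equisingularlift-5 g0 (prover, 2026-08-31; cell `pub/decomp-res`; item (r1) of leafhand-4's repair census, scheme-theoretic half).  Crux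
`EquisingularLiftNatThree` (`stmt-…-20148`; uniform in `n`, so also `stmt-…-20038` / `stmt-…-15660`), line W4.5(b), RUNG LC.  DEF-FREE; no `sorry`;
standard axioms; ZERO named hypotheses; `--supports stmt-…-20148 --as helper`, counted 0.

The set-level dictionary ✓ `LargeChar.isIso_or_exists_prime_form_range_eq_of_hyp` (…NatHypLocPrincipalForm) gives `range ι = V₊(F)` for a prime form.
Here the same is upgraded to IDEAL SHEAVES and SCHEMES, using ✓ `isIntegral_subscheme_projIdealSheaf_form` (…NatLargeCharKInputs: the form
ideal sheaf `(F)~` of a prime form has INTEGRAL zero scheme, `n ≥ 1`) and Stacks 01J3 (a closed subscheme with reduced source is the reduced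
induced structure on its image, ✓ `eq_vanishingIdeal_support_of_isReduced_subscheme`):

* `ker_eq_vanishingIdeal_range` — for a closed immersion `ι` with REDUCED source, `ker ι = 𝓘(range ι)` (the reduced ideal of the image);
* ★ `ker_eq_projIdealSheaf_form` — `ι : H ↪ ℙⁿ_k` closed, `H` integral, `range ι = V₊(F)` with `F` a PRIME form, `n ≥ 1` ⟹ `ker ι = (F)~`
  (hand-4's spelling `projIdealSheaf ⟨span (range fun _ : Fin 1 => F), _⟩`), and ★ `exists_iso_subscheme_projIdealSheaf_form` ⟹ `H ≅ V(F)` OVER `ℙⁿ_k`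
  (Mathlib `IsClosedImmersion.lift` / `isIso_lift`);
* ★★ `isIso_or_exists_prime_form_ker_eq_of_hyp` — **from the crux's verbatim hypotheses**: `ι` is an isomorphism OR `ker ι = (F)~` for a prime form `F`
  of degree `≥ 1` with `range ι = V₊(F)` (for `n = 0` only the first case occurs).

HONEST: dictionary only; EL♮(3) / EL♮ / `EquisingularLift` NOT proved; no registered stub closed; resolution in positive characteristic NOT proved.
AI-written; AI review is weaker than expert review. [cite: StacksProject, Tag 01J3] [cite: Hartshorne1977, II Prop. 5.9 and Cor. 5.16] (method; index only)
-/

set_option linter.dupNamespace false -- mandated namespace `Summit.<Summit>.<Problem>` of this single-conjunct summit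

noncomputable section

open CategoryTheory CategoryTheory.Limits AlgebraicGeometry TopologicalSpace Topology
open MvPolynomial
open Literature.AlgebraicGeometry.Resolution Literature.AlgebraicGeometry.Motives
open AlgebraicGeometry.Scheme.IdealSheafData

universe u

namespace Summit.ResolutionOfSingularities.ResolutionOfSingularities.Cruxes.EquisingularLiftNat.Sections

namespace LargeChar

/-- **The kernel of a closed immersion with reduced source is the reduced ideal of its image** (Stacks 01J3). [cite: StacksProject, Tag 01J3] -/
theorem ker_eq_vanishingIdeal_range {X H : Scheme.{u}} (ι : H ⟶ X) [IsClosedImmersion ι] [IsReduced H] :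
    ι.ker = vanishingIdeal ⟨Set.range ι, ι.isClosedEmbedding.isClosed_range⟩ := by
  have hker : (ι.ker).subschemeι.ker = ι.ker := ker_subschemeι _
  haveI : IsIso (IsClosedImmersion.lift (ι.ker).subschemeι ι hker.le) := IsClosedImmersion.isIso_lift _ _ hker
  haveI : IsReduced (ι.ker).subscheme :=
    isReduced_of_isOpenImmersion (inv (IsClosedImmersion.lift (ι.ker).subschemeι ι hker.le))
  have h1 : vanishingIdeal (ι.ker).support = ι.ker := eq_vanishingIdeal_support_of_isReduced_subscheme _
  rw [← h1]
  congr 1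
  apply Closeds.ext
  change ((ι.ker).support : Set X) = Set.range ι
  rw [Scheme.Hom.support_ker, ι.isClosedEmbedding.isClosed_range.closure_eq]

section Form

variable {k : Type} [Field k] {n : ℕ} {H : Scheme.{0}}

/-- ★ **`ker ι = (F)~`.**  For a closed immersion `ι : H ↪ ℙⁿ_k` (`n ≥ 1`) with INTEGRAL `H` whose image is the zero locus `V₊(F)` of a PRIME form
`F` of degree `e`, the kernel ideal sheaf of `ι` IS the form ideal sheaf `(F)~` (both are the reduced ideal of `V₊(F)`: `H` is reduced, and `(F)~`
has integral zero scheme ✓ `isIntegral_subscheme_projIdealSheaf_form`). [cite: StacksProject, Tag 01J3] [OURS · DEF-FREE] -/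
theorem ker_eq_projIdealSheaf_form (ι : H ⟶ (Literature.AlgebraicGeometry.Motives.projectiveSpace n k).left) [IsClosedImmersion ι]
    [IsIntegral H] (hn : 1 ≤ n) {e : ℕ} (F : MvPolynomial (Fin (n + 1)) k) (hF : F.IsHomogeneous e) (hprime : Prime F)
    (hrange : letI := MvPolynomial.gradedAlgebra (σ := Fin (n + 1)) (R := k)
      Set.range ι = {x : Proj (homogeneousSubmodule (Fin (n + 1)) k) | F ∈ x.asHomogeneousIdeal}) :
    letI := MvPolynomial.gradedAlgebra (σ := Fin (n + 1)) (R := k)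
    ι.ker = projIdealSheaf (homogeneousSubmodule (Fin (n + 1)) k)
      ⟨Ideal.span (Set.range fun _ : Fin 1 => F),
        isHomogeneous_span_of_forall_mem _ (fun _ : Fin 1 => F) (fun _ => e)
          (fun _ => (mem_homogeneousSubmodule e F).2 hF)⟩ := by
  letI := MvPolynomial.gradedAlgebra (σ := Fin (n + 1)) (R := k)
  set J : (Proj (homogeneousSubmodule (Fin (n + 1)) k)).IdealSheafData :=
    projIdealSheaf (homogeneousSubmodule (Fin (n + 1)) k)
      ⟨Ideal.span (Set.range fun _ : Fin 1 => F),
        isHomogeneous_span_of_forall_mem _ (fun _ : Fin 1 => F) (fun _ => e)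
          (fun _ => (mem_homogeneousSubmodule e F).2 hF)⟩ with hJ
  haveI : IsIntegral J.subscheme := isIntegral_subscheme_projIdealSheaf_form k n hn F hF hprime
  have hJv : vanishingIdeal J.support = J := eq_vanishingIdeal_support_of_isReduced_subscheme _
  have hI : ι.ker = vanishingIdeal ⟨Set.range ι, ι.isClosedEmbedding.isClosed_range⟩ := ker_eq_vanishingIdeal_range ι
  rw [hI, ← hJv]
  congr 1
  apply Closeds.ext
  exact hrange.trans (hJ ▸ (support_projIdealSheaf_form k n F hF).symm)

/-- ★ **`H ≅ V(F)` over `ℙⁿ_k`**: under the hypotheses of `ker_eq_projIdealSheaf_form`, `H` is isomorphic OVER `ℙⁿ_k` to the zero scheme of the form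
ideal sheaf `(F)~` (the universal property of closed immersions, Mathlib `IsClosedImmersion.lift`). [OURS · DEF-FREE] [folklore] -/
theorem exists_iso_subscheme_projIdealSheaf_form (ι : H ⟶ (Literature.AlgebraicGeometry.Motives.projectiveSpace n k).left)
    [IsClosedImmersion ι] [IsIntegral H] (hn : 1 ≤ n) {e : ℕ} (F : MvPolynomial (Fin (n + 1)) k) (hF : F.IsHomogeneous e)
    (hprime : Prime F)
    (hrange : letI := MvPolynomial.gradedAlgebra (σ := Fin (n + 1)) (R := k)
      Set.range ι = {x : Proj (homogeneousSubmodule (Fin (n + 1)) k) | F ∈ x.asHomogeneousIdeal}) :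
    letI := MvPolynomial.gradedAlgebra (σ := Fin (n + 1)) (R := k)
    ∃ φ : H ≅ (projIdealSheaf (homogeneousSubmodule (Fin (n + 1)) k)
      ⟨Ideal.span (Set.range fun _ : Fin 1 => F),
        isHomogeneous_span_of_forall_mem _ (fun _ : Fin 1 => F) (fun _ => e)
          (fun _ => (mem_homogeneousSubmodule e F).2 hF)⟩).subscheme,
      φ.hom ≫ (projIdealSheaf (homogeneousSubmodule (Fin (n + 1)) k)
        ⟨Ideal.span (Set.range fun _ : Fin 1 => F),
          isHomogeneous_span_of_forall_mem _ (fun _ : Fin 1 => F) (fun _ => e)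
            (fun _ => (mem_homogeneousSubmodule e F).2 hF)⟩).subschemeι = ι := by
  letI := MvPolynomial.gradedAlgebra (σ := Fin (n + 1)) (R := k)
  set J : (Proj (homogeneousSubmodule (Fin (n + 1)) k)).IdealSheafData :=
    projIdealSheaf (homogeneousSubmodule (Fin (n + 1)) k)
      ⟨Ideal.span (Set.range fun _ : Fin 1 => F),
        isHomogeneous_span_of_forall_mem _ (fun _ : Fin 1 => F) (fun _ => e)
          (fun _ => (mem_homogeneousSubmodule e F).2 hF)⟩ with hJ
  -- the `Proj` spelling of `ι` (instances are found on it)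
  let ι' : H ⟶ Proj (homogeneousSubmodule (Fin (n + 1)) k) := ι
  haveI : IsClosedImmersion ι' := ‹IsClosedImmersion ι›
  have hker : J.subschemeι.ker = ι'.ker := by
    rw [ker_subschemeι, hJ]
    exact (ker_eq_projIdealSheaf_form ι hn F hF hprime hrange).symm
  haveI := IsClosedImmersion.isIso_lift _ _ hker
  exact ⟨asIso (IsClosedImmersion.lift J.subschemeι ι' hker.le), IsClosedImmersion.lift_fac _ _ hker.le⟩

/-- ★★ **The crux hypothesis, scheme-theoretically.**  `ι : H ↪ ℙⁿ_k` a closed immersion, `H` integral, `(ker ι)(U)` principal near every point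
(`HypLocPrincipal`, verbatim) ⟹ EITHER `ι` is an isomorphism OR `ker ι = (F)~` AND `range ι = V₊(F)` for a PRIME FORM `F` of degree `e ≥ 1`
(for `n = 0` only the first case occurs: `ℙ⁰` is a point).  = ✓ `isIso_or_exists_prime_form_range_eq_of_hyp` + `ker_eq_projIdealSheaf_form`.
[OURS · L1 W4.5b · crux-hypothesis packaging, scheme-theoretic; DEF-FREE] -/
theorem isIso_or_exists_prime_form_ker_eq_of_hyp (ι : H ⟶ (Literature.AlgebraicGeometry.Motives.projectiveSpace n k).left)
    [IsClosedImmersion ι] [IsIntegral H]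
    (hpr : ∀ y : (Literature.AlgebraicGeometry.Motives.projectiveSpace n k).left,
      ∃ U : (Literature.AlgebraicGeometry.Motives.projectiveSpace n k).left.affineOpens,
        y ∈ (U : (Literature.AlgebraicGeometry.Motives.projectiveSpace n k).left.Opens) ∧ (ι.ker.ideal U).IsPrincipal) :
    IsIso ι ∨ ∃ (e : ℕ) (F : MvPolynomial (Fin (n + 1)) k) (hF : F.IsHomogeneous e), 0 < e ∧ Prime F ∧
      letI := MvPolynomial.gradedAlgebra (σ := Fin (n + 1)) (R := k)
      Set.range ι = {x : Proj (homogeneousSubmodule (Fin (n + 1)) k) | F ∈ x.asHomogeneousIdeal} ∧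
      ι.ker = projIdealSheaf (homogeneousSubmodule (Fin (n + 1)) k)
        ⟨Ideal.span (Set.range fun _ : Fin 1 => F),
          isHomogeneous_span_of_forall_mem _ (fun _ : Fin 1 => F) (fun _ => e)
            (fun _ => (mem_homogeneousSubmodule e F).2 hF)⟩ := by
  letI := MvPolynomial.gradedAlgebra (σ := Fin (n + 1)) (R := k)
  rcases isIso_or_exists_prime_form_range_eq_of_hyp ι hpr with hiso | ⟨e, F, he, hF, hprime, hgen, hrange⟩
  · exact Or.inl hiso
  · right
    cases n with
    | zero =>
      -- `ℙ⁰`: a non-zero form lies in no relevant prime, contradicting `F ∈ 𝔭_{ι(η_H)} = (F)`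
      exfalso
      have hFmem : F ∈ ((ι (genericPoint H)).asHomogeneousIdeal).toIdeal := by
        rw [hgen]; exact Ideal.mem_span_singleton_self F
      exact not_mem_asHomogeneousIdeal_of_fin_one k F hF hprime.ne_zero (ι (genericPoint H)) hFmem
    | succ d =>
      exact ⟨e, F, hF, he, hprime, hrange, ker_eq_projIdealSheaf_form ι (by omega) F hF hprime hrange⟩

end Form

end LargeChar

end Summit.ResolutionOfSingularities.ResolutionOfSingularities.Cruxes.EquisingularLiftNat.Sections

end
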